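import Mathlib
import Literature.RepresentationTheory.HeisenbergGroup.HeisenbergGroup
import HarnessLib

/-!
# The lattice model of the Heisenberg representation attached to a pair of lattices in duality

Topic `RepresentationTheory/HeisenbergGroup`; namespace `Literature.RepresentationTheory.HeisenbergGroup.LatticeModel`.
Definitions + kernel theorems; no named fact, no `sorry`.

Let `H = Heisenberg (polar β)` be the polarised Heisenberg group of a pairing `β : X × Y → R` (law
`(x, y, t)(x', y', t') = (x + x', y + y', t + t' + β x y')`, Weil's `A(X)`), `ψ` a unitary character of `R`, and
`B₁ ≤ X`, `B₂ ≤ Y` additive subgroups with `ψ(β(B₁, B₂)) = 1` (e.g. a dual lattice pair, `DualLatticePair.lean`).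
Then `A = B₁ × B₂ × R` is a subgroup of `H` (normal, since `[H, H] ⊆ R`) on which `ψ_A(b₁, b₂, t) = ψ(t)` is a
character, and the **lattice model** is the induced representation `Ind_A^H ψ_A` realised on
`ℓ²(A\H; E) = lp (fun _ : (X × Y)/(B₁ × B₂) => E) 2` with coefficients in an auxiliary inner-product space `E`
(MVW, Chap. 2, I.3 / II.8 "modèle latticiel"; Weil 1964 n° 12–13; for `E = ℂ` this is the representation whose
irreducibility gives the EXISTENCE of `ρ_ψ` at the finite places / finite adeles, and a coefficient space `E` carrying
the archimedean representation gives the global `ρ_ψ` of [GelbartRogawski1991, §3.1 p. 454 L19–21] without a Hilbert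
tensor product).

Contents (§1 the covariant extension `ext` of a function on `A\H` along a set-theoretic section `sec`, its
`A`-covariance `ext_mul_left` and the decomposition `H = A · sec(A\H)`; §2 the action `act h F = ext F (sec · h)`, a
group action (`act_one`, `act_mul`) by "permutation with phases" (`act_apply`, `norm_act_apply`); §3 the unitary
representation **`rep`** on `ℓ²(A\H; E)`: `norm_rep_apply` (isometric), `rep_ofCenter` (central character `ψ`);
§4 the commuting coefficient representation **`coeff`** of a group acting isometrically on `E` and `rep_coeff_comm`).
Irreducibility and continuity are proved in the sequel files.

## References
* [MoeglinVignerasWaldspurger1987] C. Mœglin, M.-F. Vignéras, J.-L. Waldspurger, LNM 1291 (1987), Chap. 2, I.3, II.8.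
* [Weil1964] A. Weil, Acta Math. 111 (1964), Chap. I n° 12–13.
* [GelbartRogawski1991] S. Gelbart, J. Rogawski, Invent. Math. 105 (1991), §3.1 p. 454 L19–21.
-/

set_option autoImplicit false

noncomputable section

open scoped ENNReal

namespace Literature.RepresentationTheory.HeisenbergGroup

namespace LatticeModel

variable {Rf : Type*} [CommRing Rf] {Xf Yf : Type*} [AddCommGroup Xf] [Module Rf Xf] [AddCommGroup Yf] [Module Rf Yf]
  (β : Xf →ₗ[Rf] Yf →ₗ[Rf] Rf) (ψ : AddChar Rf Circle) (B₁ : AddSubgroup Xf) (B₂ : AddSubgroup Yf)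
  (E : Type*) [NormedAddCommGroup E] [InnerProductSpace ℂ E]

/-! ## §1 The section and the covariant extension -/

/-- a set-theoretic section of `X × Y → (X × Y)/(B₁ × B₂)` (`= A\H`). [cite: MoeglinVignerasWaldspurger1987, Chap. 2 I.3] -/
def sec (q : (Xf × Yf) ⧸ B₁.prod B₂) : Xf × Yf := Quotient.out q

/-- `sec q` represents `q`. [cite: MoeglinVignerasWaldspurger1987, Chap. 2 I.3] -/
@[simp] theorem mk_sec (q : (Xf × Yf) ⧸ B₁.prod B₂) :
    (QuotientAddGroup.mk (sec B₁ B₂ q) : (Xf × Yf) ⧸ B₁.prod B₂) = q :=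
  Quotient.out_eq q

/-- the lattice part `v − sec [v]` of a vector lies in `B₁ × B₂`. [cite: MoeglinVignerasWaldspurger1987, Chap. 2 I.3] -/
theorem sub_sec_mem (v : Xf × Yf) :
    v - sec B₁ B₂ (QuotientAddGroup.mk v : (Xf × Yf) ⧸ B₁.prod B₂) ∈ B₁.prod B₂ := by
  have h : (QuotientAddGroup.mk (sec B₁ B₂ (QuotientAddGroup.mk v : (Xf × Yf) ⧸ B₁.prod B₂)) :
      (Xf × Yf) ⧸ B₁.prod B₂) = QuotientAddGroup.mk v := mk_sec B₁ B₂ _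
  rw [QuotientAddGroup.eq] at h
  rwa [sub_eq_add_neg, add_comm]

/-- the **phase** of `g ∈ H`: writing `g = (b₁, b₂, s) · (sec [g.v], 0)` with `(b₁, b₂) ∈ B₁ × B₂`, this is `ψ(s)`,
`s = g.t − β b₁ (sec [g.v]).2`. [cite: MoeglinVignerasWaldspurger1987, Chap. 2 I.3] -/
def phase (g : Heisenberg (polar β)) : Circle :=
  ψ (g.t - β (g.v - sec B₁ B₂ (QuotientAddGroup.mk g.v : (Xf × Yf) ⧸ B₁.prod B₂)).1
    (sec B₁ B₂ (QuotientAddGroup.mk g.v : (Xf × Yf) ⧸ B₁.prod B₂)).2)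

/-- the decomposition `g = (b₁, b₂, s) · (sec [g.v], 0)` of an element of `H` along `A = B₁ × B₂ × R`.
[cite: MoeglinVignerasWaldspurger1987, Chap. 2 I.3] -/
theorem decomp (g : Heisenberg (polar β)) :
    g = (⟨g.v - sec B₁ B₂ (QuotientAddGroup.mk g.v : (Xf × Yf) ⧸ B₁.prod B₂),
          g.t - β (g.v - sec B₁ B₂ (QuotientAddGroup.mk g.v : (Xf × Yf) ⧸ B₁.prod B₂)).1
            (sec B₁ B₂ (QuotientAddGroup.mk g.v : (Xf × Yf) ⧸ B₁.prod B₂)).2⟩ : Heisenberg (polar β)) *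
        ⟨sec B₁ B₂ (QuotientAddGroup.mk g.v : (Xf × Yf) ⧸ B₁.prod B₂), 0⟩ := by
  apply Heisenberg.ext
  · simp only [Heisenberg.mul_v, sub_add_cancel]
  · simp only [Heisenberg.mul_t, polar_apply, add_zero, sub_add_cancel]

/-- the **covariant extension** `ext F : H → E` of `F : A\H → E`: `ext F g = phase(g) • F [g.v]`, the unique
function with `ext F ((b₁, b₂, s) · g) = ψ(s) ext F g` and `ext F (sec q, 0) = F q`.
[cite: MoeglinVignerasWaldspurger1987, Chap. 2 I.3] -/
def ext (F : (Xf × Yf) ⧸ B₁.prod B₂ → E) (g : Heisenberg (polar β)) : E :=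
  ((phase β ψ B₁ B₂ g : ℂ)) • F (QuotientAddGroup.mk g.v)

/-- `ext F (sec q, 0) = F q`. [cite: MoeglinVignerasWaldspurger1987, Chap. 2 I.3] -/
theorem ext_sec (F : (Xf × Yf) ⧸ B₁.prod B₂ → E) (q : (Xf × Yf) ⧸ B₁.prod B₂) :
    ext β ψ B₁ B₂ E F ⟨sec B₁ B₂ q, 0⟩ = F q := by
  simp only [ext, phase, mk_sec, sub_self, Prod.fst_zero, map_zero, LinearMap.zero_apply,
    AddChar.map_zero_eq_one, Circle.coe_one, one_smul]

variable (hψ : ∀ x ∈ B₁, ∀ y ∈ B₂, ψ (β x y) = 1)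

include hψ in
/-- the phase is `A`-covariant: `phase((b, s) · g) = ψ(s) · phase(g)` for `b ∈ B₁ × B₂`.
[cite: MoeglinVignerasWaldspurger1987, Chap. 2 I.3] -/
theorem phase_mul_left {b : Xf × Yf} (hb : b ∈ B₁.prod B₂) (s : Rf) (g : Heisenberg (polar β)) :
    phase β ψ B₁ B₂ ((⟨b, s⟩ : Heisenberg (polar β)) * g) = ψ s * phase β ψ B₁ B₂ g := by
  have hbg : (QuotientAddGroup.mk (b + g.v) : (Xf × Yf) ⧸ B₁.prod B₂) = QuotientAddGroup.mk g.v := by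
    rw [QuotientAddGroup.eq, show -(b + g.v) + g.v = -b by abel]
    exact neg_mem hb
  unfold phase
  rw [Heisenberg.mul_v, Heisenberg.mul_t, polar_apply, hbg, ← AddChar.map_add_eq_mul]
  set σ := sec B₁ B₂ (QuotientAddGroup.mk g.v : (Xf × Yf) ⧸ B₁.prod B₂) with hσ
  have hd : g.v - σ ∈ B₁.prod B₂ := sub_sec_mem B₁ B₂ g.v
  have key : ψ (β b.1 (g.v - σ).2) = 1 := hψ b.1 hb.1 (g.v - σ).2 hd.2
  have hP : s + g.t + β b.1 g.v.2 - β (b + g.v - σ).1 σ.2 =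
      (s + (g.t - β (g.v - σ).1 σ.2)) + β b.1 (g.v - σ).2 := by
    simp only [Prod.fst_add, Prod.fst_sub, Prod.snd_sub, map_add, map_sub, LinearMap.add_apply,
      LinearMap.sub_apply]
    ring
  rw [hP, AddChar.map_add_eq_mul, key, mul_one]

include hψ in
/-- **`A`-covariance**: `ext F ((b₁, b₂, s) · g) = ψ(s) • ext F g` for `b₁ ∈ B₁`, `b₂ ∈ B₂` (here `ψ(β(B₁, B₂)) = 1` is
used). [cite: MoeglinVignerasWaldspurger1987, Chap. 2 I.3] -/
theorem ext_mul_left (F : (Xf × Yf) ⧸ B₁.prod B₂ → E) {b : Xf × Yf} (hb : b ∈ B₁.prod B₂) (s : Rf)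
    (g : Heisenberg (polar β)) :
    ext β ψ B₁ B₂ E F ((⟨b, s⟩ : Heisenberg (polar β)) * g) = ((ψ s : Circle) : ℂ) • ext β ψ B₁ B₂ E F g := by
  have hbg : (QuotientAddGroup.mk (b + g.v) : (Xf × Yf) ⧸ B₁.prod B₂) = QuotientAddGroup.mk g.v := by
    rw [QuotientAddGroup.eq, show -(b + g.v) + g.v = -b by abel]
    exact neg_mem hb
  unfold ext
  rw [phase_mul_left β ψ B₁ B₂ hψ hb s g, Heisenberg.mul_v, hbg, Circle.coe_mul, mul_smul]

include hψ in
/-- **`ext` intertwines**: for the decomposition `g = a_g · (sec [g.v], 0)`, `ext F g = ψ(s_g) • F [g.v]` — recorded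
as the evaluation of `ext F` through `decomp`. [cite: MoeglinVignerasWaldspurger1987, Chap. 2 I.3] -/
theorem ext_eq_smul_ext_sec (F : (Xf × Yf) ⧸ B₁.prod B₂ → E) (g : Heisenberg (polar β)) :
    ext β ψ B₁ B₂ E F g =
      ((ψ (g.t - β (g.v - sec B₁ B₂ (QuotientAddGroup.mk g.v : (Xf × Yf) ⧸ B₁.prod B₂)).1
          (sec B₁ B₂ (QuotientAddGroup.mk g.v : (Xf × Yf) ⧸ B₁.prod B₂)).2) : Circle) : ℂ) •
        ext β ψ B₁ B₂ E F ⟨sec B₁ B₂ (QuotientAddGroup.mk g.v : (Xf × Yf) ⧸ B₁.prod B₂), 0⟩ := by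
  conv_lhs => rw [decomp β B₁ B₂ g]
  exact ext_mul_left β ψ B₁ B₂ E hψ F (sub_sec_mem B₁ B₂ g.v) _ _

/-! ## §2 The action on functions `A\H → E` -/

/-- **the induced action** on functions `F : A\H → E`: `(act h F)(q) = ext F ((sec q, 0) · h)` (right translation
of the covariant extension, read back on the section). [cite: MoeglinVignerasWaldspurger1987, Chap. 2 I.3] -/
def act (h : Heisenberg (polar β)) (F : (Xf × Yf) ⧸ B₁.prod B₂ → E) : (Xf × Yf) ⧸ B₁.prod B₂ → E :=
  fun q => ext β ψ B₁ B₂ E F (⟨sec B₁ B₂ q, 0⟩ * h)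

/-- explicit formula: `(act h F)(q) = phase((sec q, 0) · h) • F (q + [h.v])` — a permutation of `A\H` with
unimodular phases. [cite: MoeglinVignerasWaldspurger1987, Chap. 2 I.3] -/
theorem act_apply (h : Heisenberg (polar β)) (F : (Xf × Yf) ⧸ B₁.prod B₂ → E) (q : (Xf × Yf) ⧸ B₁.prod B₂) :
    act β ψ B₁ B₂ E h F q =
      ((phase β ψ B₁ B₂ (⟨sec B₁ B₂ q, 0⟩ * h) : ℂ)) • F (q + QuotientAddGroup.mk h.v) := by
  unfold act ext
  rw [Heisenberg.mul_v, QuotientAddGroup.mk_add, mk_sec]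

/-- the action preserves pointwise norms up to the permutation: `‖(act h F) q‖ = ‖F (q + [h.v])‖`.
[cite: MoeglinVignerasWaldspurger1987, Chap. 2 I.3] -/
theorem norm_act_apply (h : Heisenberg (polar β)) (F : (Xf × Yf) ⧸ B₁.prod B₂ → E) (q : (Xf × Yf) ⧸ B₁.prod B₂) :
    ‖act β ψ B₁ B₂ E h F q‖ = ‖F (q + QuotientAddGroup.mk h.v)‖ := by
  rw [act_apply, norm_smul, Circle.norm_coe, one_mul]

include hψ in
/-- `ext (act h F) g = ext F (g · h)`: `act` is right translation on covariant functions.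
[cite: MoeglinVignerasWaldspurger1987, Chap. 2 I.3] -/
theorem ext_act (h : Heisenberg (polar β)) (F : (Xf × Yf) ⧸ B₁.prod B₂ → E) (g : Heisenberg (polar β)) :
    ext β ψ B₁ B₂ E (act β ψ B₁ B₂ E h F) g = ext β ψ B₁ B₂ E F (g * h) := by
  rw [ext_eq_smul_ext_sec β ψ B₁ B₂ E hψ, ext_sec]
  conv_rhs => rw [decomp β B₁ B₂ g, mul_assoc, ext_mul_left β ψ B₁ B₂ E hψ F (sub_sec_mem B₁ B₂ g.v)]
  rfl

/-- `act 1 = id`. [cite: MoeglinVignerasWaldspurger1987, Chap. 2 I.3] -/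
theorem act_one (F : (Xf × Yf) ⧸ B₁.prod B₂ → E) : act β ψ B₁ B₂ E 1 F = F := by
  funext q
  unfold act
  rw [mul_one, ext_sec]

include hψ in
/-- `act (h h') = act h ∘ act h'`. [cite: MoeglinVignerasWaldspurger1987, Chap. 2 I.3] -/
theorem act_mul (h h' : Heisenberg (polar β)) (F : (Xf × Yf) ⧸ B₁.prod B₂ → E) :
    act β ψ B₁ B₂ E (h * h') F = act β ψ B₁ B₂ E h (act β ψ B₁ B₂ E h' F) := by
  funext q
  change ext β ψ B₁ B₂ E F (⟨sec B₁ B₂ q, 0⟩ * (h * h')) =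
    ext β ψ B₁ B₂ E (act β ψ B₁ B₂ E h' F) (⟨sec B₁ B₂ q, 0⟩ * h)
  rw [ext_act β ψ B₁ B₂ E hψ, mul_assoc]

/-- `act h` is additive in `F`. [cite: MoeglinVignerasWaldspurger1987, Chap. 2 I.3] -/
theorem act_add (h : Heisenberg (polar β)) (F G : (Xf × Yf) ⧸ B₁.prod B₂ → E) :
    act β ψ B₁ B₂ E h (F + G) = act β ψ B₁ B₂ E h F + act β ψ B₁ B₂ E h G := by
  funext q
  simp only [act_apply, Pi.add_apply, smul_add]

/-- `act h` is `ℂ`-homogeneous in `F`. [cite: MoeglinVignerasWaldspurger1987, Chap. 2 I.3] -/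
theorem act_smul (h : Heisenberg (polar β)) (c : ℂ) (F : (Xf × Yf) ⧸ B₁.prod B₂ → E) :
    act β ψ B₁ B₂ E h (c • F) = c • act β ψ B₁ B₂ E h F := by
  funext q
  simp only [act_apply, Pi.smul_apply, smul_comm c]

/-- the centre acts by `ψ`: `act (0, t) F = ψ(t) • F`. [cite: MoeglinVignerasWaldspurger1987, Chap. 2 I.3] -/
theorem act_ofCenter (t : Rf) (F : (Xf × Yf) ⧸ B₁.prod B₂ → E) :
    act β ψ B₁ B₂ E (Heisenberg.ofCenter (polar β) (Multiplicative.ofAdd t)) F = ((ψ t : Circle) : ℂ) • F := by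
  funext q
  rw [act_apply, Pi.smul_apply]
  have hv : (Heisenberg.ofCenter (polar β) (Multiplicative.ofAdd t)).v = 0 := rfl
  have ht : (Heisenberg.ofCenter (polar β) (Multiplicative.ofAdd t)).t = t := rfl
  rw [hv, QuotientAddGroup.mk_zero, add_zero]
  congr 2
  unfold phase
  simp only [Heisenberg.mul_v, Heisenberg.mul_t, hv, ht, add_zero, zero_add, map_zero, mk_sec, sub_self,
    Prod.fst_zero, LinearMap.zero_apply, sub_zero]

/-! ## §3 The unitary representation on `ℓ²(A\H; E)` -/

set_option maxHeartbeats 400000 in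
/-- `act h` preserves square-summability (it permutes `A\H` and multiplies by unimodular phases).
[cite: MoeglinVignerasWaldspurger1987, Chap. 2 I.3] -/
theorem memℓp_act (h : Heisenberg (polar β)) (F : lp (fun _ : (Xf × Yf) ⧸ B₁.prod B₂ => E) 2) :
    Memℓp (act β ψ B₁ B₂ E h F) 2 := by
  have h2 : 0 < (2 : ℝ≥0∞).toReal := by norm_num
  rw [memℓp_gen_iff h2]
  have hF := (lp.memℓp F).summable h2
  simp only [norm_act_apply]
  exact (Equiv.addRight (QuotientAddGroup.mk h.v : (Xf × Yf) ⧸ B₁.prod B₂)).summable_iff.2 hF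

/-- `act h` as a linear endomorphism of `ℓ²(A\H; E)`. [cite: MoeglinVignerasWaldspurger1987, Chap. 2 I.3] -/
def actLp (h : Heisenberg (polar β)) :
    lp (fun _ : (Xf × Yf) ⧸ B₁.prod B₂ => E) 2 →ₗ[ℂ] lp (fun _ : (Xf × Yf) ⧸ B₁.prod B₂ => E) 2 where
  toFun F := ⟨act β ψ B₁ B₂ E h F, memℓp_act β ψ B₁ B₂ E h F⟩
  map_add' F G := by
    apply lp.ext
    change act β ψ B₁ B₂ E h (⇑F + ⇑G) = act β ψ B₁ B₂ E h F + act β ψ B₁ B₂ E h G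
    exact act_add β ψ B₁ B₂ E h F G
  map_smul' c F := by
    apply lp.ext
    change act β ψ B₁ B₂ E h (c • ⇑F) = c • act β ψ B₁ B₂ E h F
    exact act_smul β ψ B₁ B₂ E h c F

/-- coordinates of `actLp`. [cite: MoeglinVignerasWaldspurger1987, Chap. 2 I.3] -/
@[simp] theorem actLp_apply (h : Heisenberg (polar β)) (F : lp (fun _ : (Xf × Yf) ⧸ B₁.prod B₂ => E) 2)
    (q : (Xf × Yf) ⧸ B₁.prod B₂) : actLp β ψ B₁ B₂ E h F q = act β ψ B₁ B₂ E h F q := rfl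

/-- **the lattice model** `Ind_A^H ψ_A` on `ℓ²(A\H; E)` as a representation of `H = Heisenberg (polar β)` (for
`ψ(β(B₁, B₂)) = 1`). [cite: MoeglinVignerasWaldspurger1987, Chap. 2 I.3, II.8] -/
def rep : Representation ℂ (Heisenberg (polar β)) (lp (fun _ : (Xf × Yf) ⧸ B₁.prod B₂ => E) 2) where
  toFun := actLp β ψ B₁ B₂ E
  map_one' := by
    apply LinearMap.ext
    intro F
    apply lp.ext
    exact act_one β ψ B₁ B₂ E F
  map_mul' h h' := by
    apply LinearMap.ext
    intro F
    apply lp.ext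
    exact act_mul β ψ B₁ B₂ E hψ h h' F

/-- coordinates of the lattice model: `(rep h F) q = phase((sec q, 0) · h) • F (q + [h.v])`.
[cite: MoeglinVignerasWaldspurger1987, Chap. 2 I.3] -/
theorem rep_apply (h : Heisenberg (polar β)) (F : lp (fun _ : (Xf × Yf) ⧸ B₁.prod B₂ => E) 2)
    (q : (Xf × Yf) ⧸ B₁.prod B₂) :
    rep β ψ B₁ B₂ E hψ h F q = ((phase β ψ B₁ B₂ (⟨sec B₁ B₂ q, 0⟩ * h) : ℂ)) • F (q + QuotientAddGroup.mk h.v) :=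
  act_apply β ψ B₁ B₂ E h F q

/-- **the lattice model is unitary**: every `rep h` is a linear isometry of `ℓ²(A\H; E)`.
[cite: MoeglinVignerasWaldspurger1987, Chap. 2 I.3, II.8] -/
theorem norm_rep_apply (h : Heisenberg (polar β)) (F : lp (fun _ : (Xf × Yf) ⧸ B₁.prod B₂ => E) 2) :
    ‖rep β ψ B₁ B₂ E hψ h F‖ = ‖F‖ := by
  have h2 : 0 < (2 : ℝ≥0∞).toReal := by norm_num
  have h1 : ‖rep β ψ B₁ B₂ E hψ h F‖ ^ (2 : ℝ≥0∞).toReal = ‖F‖ ^ (2 : ℝ≥0∞).toReal := by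
    rw [lp.norm_rpow_eq_tsum h2, lp.norm_rpow_eq_tsum h2]
    change ∑' q, ‖act β ψ B₁ B₂ E h F q‖ ^ (2 : ℝ≥0∞).toReal = _
    simp only [norm_act_apply]
    exact (Equiv.addRight (QuotientAddGroup.mk h.v : (Xf × Yf) ⧸ B₁.prod B₂)).tsum_eq
      fun q => ‖F q‖ ^ (2 : ℝ≥0∞).toReal
  have hp : (2 : ℝ≥0∞).toReal = 2 := by norm_num
  rw [hp, Real.rpow_two, Real.rpow_two] at h1
  exact (sq_eq_sq₀ (norm_nonneg _) (norm_nonneg _)).1 h1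

/-- **the central character of the lattice model is `ψ`**. [cite: MoeglinVignerasWaldspurger1987, Chap. 2 I.3] -/
theorem rep_ofCenter (t : Rf) (F : lp (fun _ : (Xf × Yf) ⧸ B₁.prod B₂ => E) 2) :
    rep β ψ B₁ B₂ E hψ (Heisenberg.ofCenter (polar β) (Multiplicative.ofAdd t)) F = ((ψ t : Circle) : ℂ) • F := by
  apply lp.ext
  rw [lp.coeFn_smul]
  exact act_ofCenter β ψ B₁ B₂ E t F

/-! ## §4 The commuting coefficient representation -/

section Coeff

variable {G : Type*} [Group G] (π : Representation ℂ G E) (hπ : ∀ (g : G) (v : E), ‖π g v‖ = ‖v‖)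

include hπ

/-- an isometric action on the coefficients preserves square-summability. [cite: GelbartRogawski1991, §3.1 p. 454 L19–21] -/
theorem memℓp_coeff (g : G) (F : lp (fun _ : (Xf × Yf) ⧸ B₁.prod B₂ => E) 2) :
    Memℓp (fun q => π g (F q)) 2 := by
  have h2 : 0 < (2 : ℝ≥0∞).toReal := by norm_num
  rw [memℓp_gen_iff h2]
  simp only [hπ]
  exact (lp.memℓp F).summable h2

/-- the coefficient action as a linear endomorphism of `ℓ²(A\H; E)`. [cite: GelbartRogawski1991, §3.1 p. 454 L19–21] -/
def coeffLp (g : G) :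
    lp (fun _ : (Xf × Yf) ⧸ B₁.prod B₂ => E) 2 →ₗ[ℂ] lp (fun _ : (Xf × Yf) ⧸ B₁.prod B₂ => E) 2 where
  toFun F := ⟨fun q => π g (F q), memℓp_coeff B₁ B₂ E π hπ g F⟩
  map_add' F G' := by
    apply lp.ext
    funext q
    change π g ((F + G') q) = π g (F q) + π g (G' q)
    rw [lp.coeFn_add, Pi.add_apply, map_add]
  map_smul' c F := by
    apply lp.ext
    funext q
    change π g ((c • F) q) = c • π g (F q)
    rw [lp.coeFn_smul, Pi.smul_apply, map_smul]

/-- **the coefficient representation**: `G` acting coordinatewise on `ℓ²(A\H; E)` through an isometric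
representation `π` on `E` (for the adelic `ρ_ψ`: `G = H(W_∞)` acting through its Schrödinger model).
[cite: GelbartRogawski1991, §3.1 p. 454 L19–21] -/
def coeff : Representation ℂ G (lp (fun _ : (Xf × Yf) ⧸ B₁.prod B₂ => E) 2) where
  toFun := coeffLp B₁ B₂ E π hπ
  map_one' := by
    apply LinearMap.ext
    intro F
    apply lp.ext
    funext q
    change π 1 (F q) = F q
    rw [map_one]
    rfl
  map_mul' g g' := by
    apply LinearMap.ext
    intro F
    apply lp.ext
    funext q
    change π (g * g') (F q) = π g (π g' (F q))
    rw [map_mul]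
    rfl

/-- coordinates of the coefficient representation. [cite: GelbartRogawski1991, §3.1 p. 454 L19–21] -/
@[simp] theorem coeff_apply (g : G) (F : lp (fun _ : (Xf × Yf) ⧸ B₁.prod B₂ => E) 2) (q : (Xf × Yf) ⧸ B₁.prod B₂) :
    coeff B₁ B₂ E π hπ g F q = π g (F q) := rfl

/-- the coefficient representation is isometric. [cite: GelbartRogawski1991, §3.1 p. 454 L19–21] -/
theorem norm_coeff_apply (g : G) (F : lp (fun _ : (Xf × Yf) ⧸ B₁.prod B₂ => E) 2) :
    ‖coeff B₁ B₂ E π hπ g F‖ = ‖F‖ := by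
  have h2 : 0 < (2 : ℝ≥0∞).toReal := by norm_num
  have h1 : ‖coeff B₁ B₂ E π hπ g F‖ ^ (2 : ℝ≥0∞).toReal = ‖F‖ ^ (2 : ℝ≥0∞).toReal := by
    rw [lp.norm_rpow_eq_tsum h2, lp.norm_rpow_eq_tsum h2]
    change ∑' q, ‖π g (F q)‖ ^ (2 : ℝ≥0∞).toReal = _
    simp only [hπ]
  have hp : (2 : ℝ≥0∞).toReal = 2 := by norm_num
  rw [hp, Real.rpow_two, Real.rpow_two] at h1
  exact (sq_eq_sq₀ (norm_nonneg _) (norm_nonneg _)).1 h1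

/-- **the two actions commute**: `rep h (coeff g F) = coeff g (rep h F)`.
[cite: GelbartRogawski1991, §3.1 p. 454 L19–21] -/
theorem rep_coeff_comm (h : Heisenberg (polar β)) (g : G) (F : lp (fun _ : (Xf × Yf) ⧸ B₁.prod B₂ => E) 2) :
    rep β ψ B₁ B₂ E hψ h (coeff B₁ B₂ E π hπ g F) = coeff B₁ B₂ E π hπ g (rep β ψ B₁ B₂ E hψ h F) := by
  apply lp.ext
  funext q
  rw [coeff_apply, rep_apply, rep_apply, coeff_apply, map_smul]

end Coeff

end LatticeModel

end Literature.RepresentationTheory.HeisenbergGroup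

end
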